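import Literature.AlgebraicGeometry.Resolution.WeightedCentreStep
import Literature.AlgebraicGeometry.Resolution.HironakaDirectrixLemmas
import HarnessLib

/-!
# The DIRECTRIX RULE for the weighted step: `τ(in_ν G) ≥ 2` decides DROP at position 2

Companion to `WeightedCentreStep` (§4, the verdict predicates `StepDrops` / `StepStalls` of the
resolution observatory's FE30 step census) and to the FIRST BLOCK of `W(g)` proved in
`WeightedCentreInvariantSet` (`replicate_prefix_or_lt`: for every centre for a germ `g` of order `ν`,
EITHER `(ν, …, ν)` — `τ = τ(in_ν g)` entries, `τ` = Hironaka's `τ` of the initial form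
(`hironakaTau k {homogeneousComponent ν g}`) — is a prefix of its invariant, OR the invariant is
`TruncLex`-below `(ν^τ)`).

[ATW24] Abramovich–Temkin–Włodarczyk, *Functorial embedded resolution via weighted blowings up*,
Algebra & Number Theory 18:8 (2024): §5.1 (p. 1575, the order: "lexicographically, with truncated
sequences considered larger"), Thm. 5.3.1 (2)–(3) and its proof (p. 1578: `inv = max` of the invariants
of admissible centres; "after reordering … a regular system of parameters"), Thm. 6.2.1 (p. 1581, the
invariant drops — characteristic `0`).  [CoP1] Cossart–Piltant, J. Algebra 320 (2008), proof of
Prop. 4.2 (`τ(x) = dim T_x`, Hironaka's directrix of the tangent cone).  [AQS24] Abramovich–Quek–Schober,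
arXiv:2412.16426, Rem. 6.2 and §6 (positive characteristic: the invariant need not drop).

## What is proved (any field `k`, any characteristic, any number of variables)

For the old certified value `a` (a list of rationals; in the census `a = max W(f)`, `a₁ = ν = ord f`)
and a new germ `g` of the SAME order `ν` (no drop at position `1`), with `τ' := τ(in_ν g)`:
* `stepDrops_of_replicate_hironakaTau_lt` — **if `(ν^{τ'}) <_TruncLex a` then `g` is a DROP against
  `a`**: every invariant of `W(g)` has the prefix `(ν^{τ'})` (hence is `≤ (ν^{τ'})`, longer lists being
  smaller) or is below it; either way it is below `a`.
* `replicate_lt_of_leadCount_lt` — the hypothesis holds as soon as `a` (sorted, entries `≥ ν`) has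
  FEWER than `τ'` leading entries equal to `ν`; so (`stepDrops_of_leadCount_lt_hironakaTau`) **a new
  germ whose initial form needs more variables than the old value has leading `ν`'s is a DROP** — read
  off `in_ν g` alone, no centre of `g` computed.  The census shape (`stepDrops_cons_cons_of_two_le_hironakaTau`,
  `stepDrops_singleton_of_two_le_hironakaTau`): `a = (ν, a₂, …)` with `a₂ > ν`, or `a = (ν)`, and
  `τ' ≥ 2` ⟹ DROP (at position `2`).
* Contrapositive, the typed form of the census observation "at a STALL point the initial form is the
  square of ONE linear form" (ENGINE 1 gen 18, C111 (i)): `hironakaTau_le_one_of_stepStalls` /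
  `hironakaTau_eq_one_of_stepStalls` — **a STALL against `a = (ν, a₂ > ν, …)` forces
  `τ(in_ν g) = 1`**: the directrix of the new initial form is a line (`in_ν g ∈ k[L]` for one linear
  form `L`, by Hironaka's `F ∈ k[T(F)]`, which is not re-proved in this library — the statement here
  is `τ = 1`).  Example: the Whitney umbrella point `G = x² + y² + y²z`: `in₂ G = x² + y²` has `τ = 2`
  when `char k ≠ 2` (DROP, as [ATW24, Thm. 6.2.1] demands) and `τ = 1` when `char k = 2`
  (`(x + y)²`; the census STALL S4#66).

NOT a resolution theorem and not progress on one: elementary consequences of the definitions, typed so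
that the census column "τ of the new initial form" has a stated meaning.  Nothing here has been reviewed
by a human expert.
-/

noncomputable section

open MvPolynomial

namespace Literature.AlgebraicGeometry.Resolution

namespace WeightedBlowup

variable {k : Type*} [Field k] {m : ℕ}

/-! ## §1 `TruncLex` against a block `(ν, …, ν)` -/

section TruncLexReplicate

/-- `(ν, ν, ν, …)` (`τ ≥ 2` entries) is below the one-entry list `(ν)` (a proper extension is smaller
than its truncation). [cite: AbramovichTemkinWlodarczyk2024, §5.1 (p. 1575) (truncated sequences are
larger)] -/
theorem replicate_lt_singleton (ν : ℚ) {τ : ℕ} (hτ : 2 ≤ τ) :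
    ATW.TruncLex.lt (List.replicate τ ν) [ν] := by
  obtain ⟨t, rfl⟩ := Nat.exists_eq_add_of_le' hτ
  rw [List.replicate_succ, List.replicate_succ, ATW.TruncLex.cons_lt_cons]
  exact Or.inr ⟨rfl, ATW.TruncLex.cons_lt_nil _ _⟩

/-- `(ν, ν, …)` (`τ ≥ 2` entries) is below `(ν, a₂, …)` whenever `a₂ > ν` (first difference at
position `2`). [cite: AbramovichTemkinWlodarczyk2024, §5.1 (p. 1575) (lexicographic comparison)] -/
theorem replicate_lt_cons_cons {ν a₂ : ℚ} (h : ν < a₂) (t : List ℚ) {τ : ℕ} (hτ : 2 ≤ τ) :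
    ATW.TruncLex.lt (List.replicate τ ν) (ν :: a₂ :: t) := by
  obtain ⟨t', rfl⟩ := Nat.exists_eq_add_of_le' hτ
  rw [List.replicate_succ, List.replicate_succ, ATW.TruncLex.cons_lt_cons, ATW.TruncLex.cons_lt_cons]
  exact Or.inr ⟨rfl, Or.inl h⟩

/-- The number of LEADING entries of `a` equal to `ν` (for the census value `a = max W(f)` of a germ of
order `ν`: the length of its first block). (observatory bookkeeping, derived here)
[cite: AbramovichTemkinWlodarczyk2024, proof of Thm. 5.3.1 (2)–(3) (p. 1578) (the block of entries `a₁`)] -/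
def leadCount (ν : ℚ) : List ℚ → ℕ
  | [] => 0
  | x :: xs => if x = ν then leadCount ν xs + 1 else 0

/-- `leadCount ν [] = 0`. [cite: AbramovichTemkinWlodarczyk2024, §5.1 (p. 1575) (the invariant as a
non-decreasing sequence; its first block)] -/
@[simp] theorem leadCount_nil (ν : ℚ) : leadCount ν [] = 0 := rfl

/-- `leadCount ν (ν :: xs) = leadCount ν xs + 1`. [cite: AbramovichTemkinWlodarczyk2024, §5.1 (p. 1575)
(the invariant as a non-decreasing sequence; its first block)] -/
@[simp] theorem leadCount_cons_self (ν : ℚ) (xs : List ℚ) :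
    leadCount ν (ν :: xs) = leadCount ν xs + 1 := by
  simp [leadCount]

/-- `leadCount ν (x :: xs) = 0` for `x ≠ ν`. [cite: AbramovichTemkinWlodarczyk2024, §5.1 (p. 1575) (the
invariant as a non-decreasing sequence; its first block)] -/
theorem leadCount_cons_of_ne {ν x : ℚ} (h : x ≠ ν) (xs : List ℚ) :
    leadCount ν (x :: xs) = 0 := by
  simp [leadCount, h]

/-- The census shapes: `leadCount ν (ν) = 1` and `leadCount ν (ν, a₂, …) = 1` for `a₂ ≠ ν`.
[cite: AbramovichTemkinWlodarczyk2024, §5.1 (p. 1575) (the invariant as a non-decreasing sequence)] -/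
theorem leadCount_cons_cons_of_ne {ν a₂ : ℚ} (h : a₂ ≠ ν) (t : List ℚ) :
    leadCount ν (ν :: a₂ :: t) = 1 := by
  rw [leadCount_cons_self, leadCount_cons_of_ne h]

/-- **Fewer than `τ` leading `ν`'s ⟹ below `(ν^τ)`.**  For a sorted list `a` with all entries `≥ ν`:
if `leadCount ν a < τ` then `(ν, …, ν)` (`τ` entries) `<_TruncLex a` — at position `leadCount + 1`
the list `a` either ends (truncation: larger) or has an entry `> ν`.
[cite: AbramovichTemkinWlodarczyk2024, §5.1 (p. 1575) (the order of invariants)] -/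
theorem replicate_lt_of_leadCount_lt (ν : ℚ) :
    ∀ (a : List ℚ) (τ : ℕ), a.Pairwise (· ≤ ·) → (∀ x ∈ a, ν ≤ x) → leadCount ν a < τ →
      ATW.TruncLex.lt (List.replicate τ ν) a
  | [], τ, _, _, hτ => by
    obtain ⟨t, rfl⟩ := Nat.exists_eq_add_of_le' (Nat.one_le_iff_ne_zero.mpr (by omega : τ ≠ 0))
    rw [List.replicate_succ]
    exact ATW.TruncLex.cons_lt_nil _ _
  | x :: xs, τ, hs, hge, hτ => by
    obtain ⟨t, rfl⟩ := Nat.exists_eq_add_of_le' (Nat.one_le_iff_ne_zero.mpr (by omega : τ ≠ 0))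
    rw [List.replicate_succ, ATW.TruncLex.cons_lt_cons]
    by_cases hx : x = ν
    · subst hx
      refine Or.inr ⟨rfl, replicate_lt_of_leadCount_lt _ xs t (List.pairwise_cons.mp hs).2
        (fun y hy => hge y (List.mem_cons_of_mem _ hy)) ?_⟩
      rw [leadCount_cons_self] at hτ
      omega
    · exact Or.inl (lt_of_le_of_ne (hge x (by simp)) (Ne.symm hx))

end TruncLexReplicate

/-! ## §2 The directrix rule -/

section DirectrixRule

/-- **`(ν^{τ'}) <_TruncLex a` ⟹ DROP against `a`** (`τ' = τ(in_ν g)`, `ord g = ν`): every invariant of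
`W(g)` has the prefix `(ν^{τ'})` — and a list with that prefix is `≤ (ν^{τ'})`, proper extensions being
smaller — or is `TruncLex`-below `(ν^{τ'})` (the first block, `replicate_prefix_or_lt`); both are below `a`.
[cite: AbramovichTemkinWlodarczyk2024, Thm. 5.3.1 (2)–(3) and its proof (p. 1578)];
[cite: CossartPiltant2008, proof of Prop. 4.2] -/
theorem stepDrops_of_replicate_hironakaTau_lt {g : MvPolynomial (Fin m) k} {ν : ℕ}
    (hg : monomialOrd (fun _ => 1) g = ν) {a : List ℚ}
    (hlt : ATW.TruncLex.lt
      (List.replicate (hironakaTau k {homogeneousComponent ν g}) (ν : ℚ)) a) :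
    StepDrops a (admissibleInvariants g) := by
  rintro b ⟨Ψ, γ, h, rfl⟩
  rcases replicate_prefix_or_lt hg h with ⟨t, ht⟩ | hb
  · cases t with
    | nil =>
      rw [List.append_nil] at ht
      rw [← ht]
      exact hlt
    | cons x t =>
      rw [← ht]
      exact ATW.TruncLex.lt_trans (ATW.TruncLex.lt_append_cons _ x t) hlt
  · exact ATW.TruncLex.lt_trans hb hlt

/-- **THE DIRECTRIX RULE.**  Old value `a` sorted with entries `≥ ν` (e.g. the certified maximum of
`W(f)`, `ord f = ν`), new germ `g` of order `ν`: if the initial form `in_ν g` needs MORE variables than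
`a` has leading `ν`'s — `leadCount ν a < τ(in_ν g)` — then `g` is a DROP against `a` (at position
`leadCount + 1`), whatever the rest of `W(g)` is.  No centre of `g` is computed.
[cite: AbramovichTemkinWlodarczyk2024, Thm. 5.3.1 (2)–(3) and its proof (p. 1578), §5.1 (p. 1575)];
[cite: CossartPiltant2008, proof of Prop. 4.2] -/
theorem stepDrops_of_leadCount_lt_hironakaTau {g : MvPolynomial (Fin m) k} {ν : ℕ}
    (hg : monomialOrd (fun _ => 1) g = ν) {a : List ℚ} (hs : a.Pairwise (· ≤ ·))
    (hge : ∀ x ∈ a, (ν : ℚ) ≤ x)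
    (hτ : leadCount (ν : ℚ) a < hironakaTau k {homogeneousComponent ν g}) :
    StepDrops a (admissibleInvariants g) :=
  stepDrops_of_replicate_hironakaTau_lt hg (replicate_lt_of_leadCount_lt _ a _ hs hge hτ)

/-- **Census shape, position 2.**  `a = (ν, a₂, …)` with `a₂ > ν` (FE30: `(2,3,3)`, `(2,5,5)`,
`(2,3,3,7)`, `(2,3,7,7)`, …) and a new germ of order `ν` whose initial form has `τ ≥ 2`: DROP (at
position `2`: the new maximum starts `(ν, ν, …)`).
[cite: AbramovichTemkinWlodarczyk2024, Thm. 5.3.1 (2)–(3) and its proof (p. 1578), §5.1 (p. 1575)];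
[cite: CossartPiltant2008, proof of Prop. 4.2] -/
theorem stepDrops_cons_cons_of_two_le_hironakaTau {g : MvPolynomial (Fin m) k} {ν : ℕ}
    (hg : monomialOrd (fun _ => 1) g = ν) (hτ : 2 ≤ hironakaTau k {homogeneousComponent ν g})
    {a₂ : ℚ} (ha₂ : (ν : ℚ) < a₂) (t : List ℚ) :
    StepDrops ((ν : ℚ) :: a₂ :: t) (admissibleInvariants g) :=
  stepDrops_of_replicate_hironakaTau_lt hg (replicate_lt_cons_cons ha₂ t hτ)

/-- **Census shape, one-entry old value.**  `a = (ν)` and a new germ of order `ν` with `τ(in_ν g) ≥ 2`: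
DROP (`(ν, ν, …) < (ν)`). [cite: AbramovichTemkinWlodarczyk2024, §5.1 (p. 1575), Thm. 5.3.1 (2)–(3)
(p. 1578)] -/
theorem stepDrops_singleton_of_two_le_hironakaTau {g : MvPolynomial (Fin m) k} {ν : ℕ}
    (hg : monomialOrd (fun _ => 1) g = ν) (hτ : 2 ≤ hironakaTau k {homogeneousComponent ν g}) :
    StepDrops [(ν : ℚ)] (admissibleInvariants g) :=
  stepDrops_of_replicate_hironakaTau_lt hg (replicate_lt_singleton _ hτ)

end DirectrixRule

/-! ## §3 What a STALL forces on the new initial form: `τ(in_ν g) = 1` -/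

section StallDirectrix

/-- **STALL ⟹ `τ ≤ leadCount`.**  If `g` (order `ν`) STALLS against `a` (sorted, entries `≥ ν`) then
its initial form needs at most `leadCount ν a` variables. [cite: AbramovichTemkinWlodarczyk2024,
Thm. 5.3.1 (2)–(3) and its proof (p. 1578)]; [cite: CossartPiltant2008, proof of Prop. 4.2] -/
theorem hironakaTau_le_leadCount_of_stepStalls {g : MvPolynomial (Fin m) k} {ν : ℕ}
    (hg : monomialOrd (fun _ => 1) g = ν) {a : List ℚ} (hs : a.Pairwise (· ≤ ·))
    (hge : ∀ x ∈ a, (ν : ℚ) ≤ x) (h : StepStalls a (admissibleInvariants g)) :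
    hironakaTau k {homogeneousComponent ν g} ≤ leadCount (ν : ℚ) a := by
  by_contra hτ
  exact not_stepStalls_of_stepDrops
    (stepDrops_of_leadCount_lt_hironakaTau hg hs hge (lt_of_not_ge hτ)) h

/-- **STALL against `(ν, a₂ > ν, …)` ⟹ `τ(in_ν g) ≤ 1`.**
[cite: AbramovichTemkinWlodarczyk2024, Thm. 5.3.1 (2)–(3) and its proof (p. 1578)];
[cite: CossartPiltant2008, proof of Prop. 4.2] -/
theorem hironakaTau_le_one_of_stepStalls {g : MvPolynomial (Fin m) k} {ν : ℕ}
    (hg : monomialOrd (fun _ => 1) g = ν) {a₂ : ℚ} (ha₂ : (ν : ℚ) < a₂) (t : List ℚ)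
    (h : StepStalls ((ν : ℚ) :: a₂ :: t) (admissibleInvariants g)) :
    hironakaTau k {homogeneousComponent ν g} ≤ 1 := by
  by_contra hτ
  exact not_stepStalls_of_stepDrops
    (stepDrops_cons_cons_of_two_le_hironakaTau hg (by omega) ha₂ t) h

/-- The initial form of a germ of order `ν` is non-zero. [folklore] -/
private theorem homogeneousComponent_ne_zero_of_monomialOrd_eq {g : MvPolynomial (Fin m) k} {ν : ℕ}
    (hg : monomialOrd (fun _ => 1) g = ν) : homogeneousComponent ν g ≠ 0 := by
  have hg0 : g ≠ 0 := by
    rintro rfl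
    rw [monomialOrd_zero] at hg
    exact ENat.top_ne_coe ν hg
  obtain ⟨d, hd, hdw⟩ := exists_weight_eq_monomialOrd (fun _ => 1) hg0
  rw [hg, Nat.cast_inj, ← Finsupp.degree_eq_weight_one] at hdw
  intro h0
  have hc : coeff d (homogeneousComponent ν g) = coeff d g := by
    rw [coeff_homogeneousComponent, if_pos hdw]
  rw [h0, coeff_zero] at hc
  exact (mem_support_iff.mp hd) hc.symm

/-- A STALL germ has a centre, so its order is positive: `0 < ν`. [folklore] -/
private theorem nu_pos_of_stepStalls {g : MvPolynomial (Fin m) k} {ν : ℕ}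
    (hg : monomialOrd (fun _ => 1) g = ν) {a : List ℚ} (h : StepStalls a (admissibleInvariants g)) :
    0 < ν := by
  obtain ⟨⟨Ψ, γ, hc, -⟩, -⟩ := h
  have hgΨ : monomialOrd (fun _ => 1) (Ψ.symm g) = ν := by
    rw [monomialOrd_one_symm_eq Ψ hc.1 g, hg]
  have hg0 : Ψ.symm g ≠ 0 := by
    intro h0
    rw [h0, monomialOrd_zero] at hgΨ
    exact ENat.top_ne_coe ν hgΨ
  obtain ⟨d, hd, hdw⟩ := exists_weight_eq_monomialOrd (fun _ => 1) hg0
  rw [hgΨ, Nat.cast_inj, ← Finsupp.degree_eq_weight_one] at hdw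
  by_contra hν
  have hν0 : ν = 0 := by omega
  rw [hν0, Finsupp.degree_eq_zero_iff] at hdw
  have h1 : (1 : ℚ) ≤ monomialValuation γ d := hc.2.2 d hd
  rw [hdw] at h1
  norm_num [monomialValuation] at h1

/-- **STALL against `(ν, a₂ > ν, …)` ⟹ `τ(in_ν g) = 1`**: the directrix of the new initial form is a
line — the typed form of the census observation "at every certified STALL point the initial form is
(the `ν`-th power of) ONE linear form" (ENGINE 1 gen 18, C111 (i); `in_ν g ∈ k[T(in_ν g)]` is
Hironaka's theorem, not re-proved in this library).  E.g. `x² + y² = (x + y)²` in characteristic `2`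
(`τ = 1`, the umbrella STALL) versus `τ(x² + y²) = 2` in characteristic `≠ 2` (DROP).
[cite: AbramovichTemkinWlodarczyk2024, Thm. 5.3.1 (2)–(3) and its proof (p. 1578), Thm. 6.2.1 (p. 1581)];
[cite: CossartPiltant2008, proof of Prop. 4.2]; [cite: AbramovichQuekSchober2024, Rem. 6.2] -/
theorem hironakaTau_eq_one_of_stepStalls {g : MvPolynomial (Fin m) k} {ν : ℕ}
    (hg : monomialOrd (fun _ => 1) g = ν) {a₂ : ℚ} (ha₂ : (ν : ℚ) < a₂) (t : List ℚ)
    (h : StepStalls ((ν : ℚ) :: a₂ :: t) (admissibleInvariants g)) :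
    hironakaTau k {homogeneousComponent ν g} = 1 := by
  refine le_antisymm (hironakaTau_le_one_of_stepStalls hg ha₂ t h) ?_
  exact one_le_hironakaTau k (Set.mem_singleton _) (nu_pos_of_stepStalls hg h)
    (homogeneousComponent_isHomogeneous ν g) (homogeneousComponent_ne_zero_of_monomialOrd_eq hg)

/-- The same against the certified old maximum of a germ `f` of order `ν` whose value has the census
shape `leadCount = 1` (read: `a = max W(f)` starts `(ν, a₂ > ν, …)` or is `(ν)`): a STALL point of the
step has `τ(in_ν G) ≤ 1`. [cite: AbramovichTemkinWlodarczyk2024, Thm. 5.3.1 (2)–(3) and its proof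
(p. 1578)]; [cite: CossartPiltant2008, proof of Prop. 4.2] -/
theorem hironakaTau_le_one_of_stepStalls_of_isMaxInv {n : ℕ} {f : MvPolynomial (Fin n) k} {ν : ℕ}
    (hν : monomialOrd (fun _ => 1) f = ν) {a : List ℚ} (ha : IsMaxInv (admissibleInvariants f) a)
    (h1 : leadCount (ν : ℚ) a ≤ 1) {g : MvPolynomial (Fin m) k}
    (hg : monomialOrd (fun _ => 1) g = ν) (h : StepStalls a (admissibleInvariants g)) :
    hironakaTau k {homogeneousComponent ν g} ≤ 1 := by
  have hsorted : a.Pairwise (· ≤ ·) := by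
    obtain ⟨⟨Ψ, γ, _, rfl⟩, -⟩ := ha
    exact exps_sorted γ
  obtain ⟨as, rfl⟩ := exists_eq_cons_of_isMaxInv hν ha
  refine (hironakaTau_le_leadCount_of_stepStalls hg hsorted (fun x hx => ?_) h).trans h1
  rcases List.mem_cons.mp hx with rfl | hx
  · exact le_rfl
  · exact (List.pairwise_cons.mp hsorted).1 x hx

end StallDirectrix

end WeightedBlowup

end Literature.AlgebraicGeometry.Resolution

end
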